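import Summits.ABC.IUTFork.Repair.RHAxisCK1Requirements
import Summits.ABC.IUTFork.Repair.RHReqsideWeightLawsBedKappaOneDatum
import HarnessLib

/-!
# R-H ROUND-3 AXIS C, item (b) TYPING LANE (ruling R79, KEY «C-TYPE-K1»), part B: knob family K1-KAPPA1 (`κ′ = 1`, linear Θ-weight law,
# CFG-01 / CFG-02 / CFG-03) over part A's parametric decls at the exponent `a = 2` (`lawPow 2 j = j`)

abc-iut cell, rung LADDER-ABC:A2.RESCUE.H; seat abc-iut-reqb-typ-1 (GEN 9; KEY `wake/KEY-abc-iut-reqb-typ-1-C-TYPE-K1.md` 884765c520d369cd, abc-iut-rh-lead g5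
2026-08-27T12:36:10Z, RULING R79); desk file `plan/rescue/R-H/ROUND3/AXIS-CD-DESK.md` 0c01fcd4427e30c7 §AXIS C; machine list `AXIS-C/AXIS-C-CONFIGS.tsv`
80c35a38b88f1870; companion of `Repair/RHAxisCK1Requirements.lean` (part A: R1–R6 PARAMETRIC in the law exponent `a`, family K1-KAPPA3/2) — split by the
400-line rule (D-0064), same namespace.
SHEETS TYPED HERE (family K1-KAPPA1, seat abc-iut-rh3-gen-1, referees rh-ref-1 / rh-ref-2 PASS ×3, labels CONSISTENT-BUT-UNMOTIVATED): CFG-01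
`AXIS-C/CFG-01-P-k1kappa1-k5mu27_64.md` v2 b48b9637cf79f32d (v1 3d6aebccef215c52) · CFG-02 `AXIS-C/CFG-02-P-k1kappa1-k5mu1_2.md` v2 a08e20e4aa0aeaf4 (v1
481e3a34f15e3527) · CFG-03 `AXIS-C/CFG-03-P-k1kappa1-k5mu3_4.md` v2 20054eaad1a1d4d1 (v1 61ca87a1c1e36568), whose §K1-CORE (b) is IDENTICAL across the three:
(b1) requirement-side R1–R6 (scratch-checked by the sheet seat: `HOME/abc-iut-rh3-gen-1/AxisCK1KappaOne.lean` af674daef04bb045, rc 0, re-run by both referees —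
CREDITED: §7 below is that block re-cut over part A's decls, CROSSWALK 12:54:52Z: sheet R1 `lawKappaOne` = `lawPow 2` (`lawPow_two_eq_id`); sheet R2
`LicenceAllLabels` = `LicenceAllLabels 2` here; sheet R3 `MeetsAt μ₀` = part A's `R1_meets 2 μ₀` (`datum_meets_iff` p522952 by name); sheet R4 `uConst_kappaOne` =
`R3_downstreamConstantKappaOne` (+ `_holds`, values); sheet R5 `DownstreamDisplay` and R6 `downstream_vacuous_of_window` verbatim) and (b2) supply-side S1–S5
(prose with signature): S1 (evaluation section with LINEAR order) + S2 (multiradial cyclotomic / discrete / constant-multiple rigidity for its class) + S3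
(F_l^{⋊±}-symmetric evaluation at a NON-ADOPTED collection, with the label caveat `kappaOne_not_downward_closed` p524026) = part A's `R4_thetaSection 2` /
`R5_cyclotomicRigidity 2` / `R6_pilotDegreeLaw 2` + the all-labels licence (sheet: «a general κ′ = 1 theory must either license ALL labels (R2) or carry a
non-segment label object»); S4 (log-shell / Θ-pilot bookkeeping with weight `j`) = «exactly R2 ∧ R3; nothing further is typed» (sheet); S5 (bounded-`l` initial
Θ-data, forced by R6) = `S5_boundedPrime` here, a requirement on the theory's `l`-SELECTION along the family of data ([IUTchI] Def 3.1 (c) — the tree's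
`Literature.IUT.HodgeTheaters.InitialThetaData F K Fbar E l P`, fields `l_prime` / `five_le_l` / `imageContainsSL2` —, against [IUTchIV] Cor 2.2 (P1) `h^{1/2} ≤ l`),
with its vacuity on any finite bed flagged (`S5_boundedPrime_of_finite`) and its failure along print's `√h`-window recorded (`not_S5_boundedPrime_of_window`).
§8 assembles `CFG01_requirement` / `CFG02_requirement` / `CFG03_requirement` = `KappaOne_requirement μ₀` at `μ₀ = 27/64, ½, ¾` (one def per configuration; the
bed words of record BY NAME: `bed_kappaOne_all` / `bed_kappaOne_exception` p508362, `exception_datum_words_L0` / `_L1` p512285, `row_kappaOne_ratio` p519304).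

HONEST FRAMING / GUARDS: every `def … : Prop` here is a HYPOTHESIS in OUR typed cell currency — what a hypothetical `κ′ = 1` theory would have to meet — not a
reading of [EtTh]/[IUTchI–IV], not a claim that such objects exist, NEVER a Literature fact (no new `Prop` fact; inputs ⊆ the frozen FACT-LIST f75a60bac22efdb6 + the
landed modules imported above); `κ′ = 1` is a PARAMETER SETTING of our currency; the `_holds` / `_iff` / window lemmas are bookkeeping arithmetic, not evidence for
any configuration; located ≠ adjudicated; typed ≠ proved; computed ≠ proved; nothing here asserts that abc is proved or refuted, or takes a side on [IUTchIII]
Cor. 3.12 / [IUTchIV] Thm. 1.10 or on any author (D-0045). [claim: Mochizuki2012, status: disputed]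
[cite: Mochizuki2012, IUTchI Def. 3.1 p. 61–63; IUTchIII Cor. 3.12 p. 173–174; IUTchIV Thm. 1.10 Step (v)–(viii) p. 27–29, Cor. 2.2 (P1) p. 45–46]
-/

noncomputable section
open Finset
namespace Summit.ABC.IUTFork.Repair.RH.AxisCK1Requirements
open Summit.ABC.IUTFork.Repair.RH.ReqsideWeightLaws

/-! ## §7. K1-KAPPA1 core (`a = 2`: `lawPow 2 j = j`, `κ′ = 1`) — the sheets' (b1) R1–R6 over part A's parametric decls, and S5 -/

section KappaOneCore

variable {ι : Type*}

/-- **Sheet R1 (the knob)**: `lawPow 2` IS the linear law `j ↦ j` as a function (sheet `lawKappaOne`, `lawKappaOne_eq_lawPow_two`; tree `lawPow_two`, p506542) —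
what must be supplied is an evaluation section whose label-`j` order is `j·m_q` (S1 = part A's `R4_thetaSection 2`). [folklore] -/
theorem lawPow_two_eq_id : lawPow 2 = fun j : ℕ => (j : ℤ) := funext lawPow_two

/-- **Sheet R2 (licence at EVERY label)**, CFG-01/02/03 §K1-CORE (b1) «`def LicenceAllLabels (e m δ rin rout : ℤ) (L : ℕ) : Prop := ∀ j : ℕ, 1 ≤ j → j ≤ L →
Cell lawKappaOne 1 e m δ rin rout j`»: at a place `(e, m, δ, r_in, r_out)` with `L = l⋆` labels, EVERY label is a cell of the law `lawPow a` — parametric in the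
exponent `a`; the κ′ = 1 sheets use `a = 2`. (The sheets' S3 caveat: the κ′ = 1 licence set is NOT downward closed in general, `kappaOne_not_downward_closed`
p524026 / part A `R6_segmentClosedAt_two_not_forall`, so a κ′ = 1 theory «must either license ALL labels (R2) or carry a non-segment label object».) HYPOTHESIS in
OUR typed cell currency. [claim: Mochizuki2012, status: disputed] -/
@[claim "Mochizuki2012" "disputed"]
def LicenceAllLabels (a : ℕ) (e m δ rin rout : ℤ) (L : ℕ) : Prop :=
  ∀ j : ℕ, 1 ≤ j → j ≤ L → Cell (lawPow a) 1 e m δ rin rout j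

/-- … DECIDED on the bed at `a = 2` by the sharp `κ = 1` saturation row: `0 < e`, `0 ≤ m`, `r_out ≤ r_in`, `(L−1)·m ≤ L·δ + (L+1)(r_in − r_out)` ⟹ every label
licensed (`cell_id_of_top_le`, p508362 — 1,530 / 1,531 bed places: `bed_kappaOne_all`, the exception `bed_kappaOne_exception`; sheet `licenceAllLabels_of_top_le`).
[folklore] -/
theorem licenceAllLabels_two_of_top_le {e m δ rin rout : ℤ} {L : ℕ} (he : 0 < e) (hm : 0 ≤ m) (hG : rout ≤ rin)
    (h : ((L : ℤ) - 1) * m ≤ (L : ℤ) * δ + ((L : ℤ) + 1) * (rin - rout)) : LicenceAllLabels 2 e m δ rin rout L := by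
  intro j hj hjL
  rw [lawPow_two_eq_id]
  exact cell_id_of_top_le he hm hG h hj (by exact_mod_cast hjL)

/-- Under part A's licence law `R1_licenceLaw a` (the theory's licence assignment matches the cell), «the theory licenses every label at the place `w`» IS
`LicenceAllLabels a` there. [folklore] -/
theorem licenceAllLabels_iff_of_R1 {a : ℕ} {s : Finset ι} {e m δ rin rout : ι → ℤ} {L : ℕ} {licensed : ι → ℕ → Prop}
    (h : R1_licenceLaw a s e m δ rin rout L licensed) {w : ι} (hw : w ∈ s) :
    LicenceAllLabels a (e w) (m w) (δ w) (rin w) (rout w) L ↔ ∀ j, 1 ≤ j → j ≤ L → licensed w j :=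
  forall₃_congr fun j hj hjL => (h w hw j hj hjL).symm

/-- All labels licensed ⟹ the licence set is (trivially) segment-closed (part A's `R6_segmentClosedAt`): R2 is the sheets' first alternative for the S3 label
caveat. [folklore] -/
theorem R6_segmentClosedAt_of_licenceAllLabels {a : ℕ} {e m δ rin rout : ℤ} {L : ℕ} (h : LicenceAllLabels a e m δ rin rout L) :
    R6_segmentClosedAt a e m δ rin rout L :=
  fun j hj hjL _ => h j hj hjL.le

/-- **Sheet R4 (downstream constant the κ′ = 1 inequality hands to a Thm-1.10-type chain)**, §K1-CORE (b1) «`uConst lawKappaOne 1 (2n+1) n =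
2(2n+1)((2n+1)+5)/((2n+1)−3)` i.e. `u₁(l) = 2l(l+5)/(l−3)` (`uConst_id` p508156) … `u₁(l) > 2l` (`two_mul_lt_uConst_id`)» — typed as BOTH clauses at every
`l = 2n+1`, `n ≥ 2`: the closed form AND the unboundedness `2l < u₁(l)` (print: `uConst_sq` `6l(l+5)/((l−3)(l+4)) → 6`; `u₁/u = (l+4)/3`). What a κ′ = 1 theory must
SUPPLY downstream is a chain tolerating `u₁(l)` in place of «6» (sheet R5/R6/S5). Bookkeeping in OUR currency (HOLDS: `_holds`). [claim: Mochizuki2012, status: disputed] -/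
@[claim "Mochizuki2012" "disputed"]
def R3_downstreamConstantKappaOne : Prop :=
  ∀ n : ℕ, 2 ≤ n →
    uConst (lawPow 2) 1 (2 * n + 1) n = 2 * (2 * (n : ℝ) + 1) * ((2 * (n : ℝ) + 1) + 5) / ((2 * (n : ℝ) + 1) - 3) ∧
      2 * (2 * (n : ℝ) + 1) < uConst (lawPow 2) 1 (2 * n + 1) n

/-- Sheet R4 HOLDS in our currency (`uConst_id`, `two_mul_lt_uConst_id`, p508156, after `lawPow 2 = id`). [folklore] -/
theorem R3_downstreamConstantKappaOne_holds : R3_downstreamConstantKappaOne := by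
  intro n hn
  rw [lawPow_two_eq_id]
  exact ⟨uConst_id hn, two_mul_lt_uConst_id hn⟩

/-- The sheets' tabulated values (`uConst_kappaOne_values`, kernel `norm_num`): `l = 5: 50 · 7: 42 · 11: 44 · 13: 234/5 · 107: 2996/13` (print at `l = 13`:
`1404/170 = 8.26`, at `107`: `6.23`). [folklore] -/
theorem uConst_lawPow_two_values :
    uConst (lawPow 2) 1 5 2 = 50 ∧ uConst (lawPow 2) 1 7 3 = 42 ∧ uConst (lawPow 2) 1 11 5 = 44 ∧
      uConst (lawPow 2) 1 13 6 = 234 / 5 ∧ uConst (lawPow 2) 1 107 53 = 2996 / 13 := by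
  rw [lawPow_two_eq_id]
  refine ⟨?_, ?_, ?_, ?_, ?_⟩
  · have h := @uConst_id 2 (by norm_num); norm_num at h; rw [h]
  · have h := @uConst_id 3 (by norm_num); norm_num at h; rw [h]
  · have h := @uConst_id 5 (by norm_num); norm_num at h; rw [h]
  · have h := @uConst_id 6 (by norm_num); norm_num at h; rw [h]
  · have h := @uConst_id 53 (by norm_num); norm_num at h; rw [h]

/-- **Sheet R5 (downstream display shape)**, §K1-CORE (b1) «`def DownstreamDisplay (l : ℕ) (logq B E : ℝ) : Prop := logq ≤ uConst lawKappaOne 1 l ((l − 1)/2) *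
(B + E)`»: with `logq = log(q)`, `B` = the `(1 + 20·d_mod/l)`-weighted log-different + log-conductor bracket and `E` = the chain's `l`-dependent error (print:
`20·(e*_mod·l + η_prm)`), the best a κ′ = 1 inequality can hand downstream is `logq ≤ u₁(l)·(B + E)` — a requirement on the κ′ theory's OUTPUT, not a claim.
[claim: Mochizuki2012, status: disputed] -/
@[claim "Mochizuki2012" "disputed"]
def DownstreamDisplay (l : ℕ) (logq B E : ℝ) : Prop :=
  logq ≤ uConst (lawPow 2) 1 l ((l - 1) / 2) * (B + E)

/-- **Sheet R6 (vacuity under print's `l`-window; pure arithmetic)** — rh3-gen-1's `downstream_vacuous_of_window` VERBATIM (credited; corrected reading 13:08:48Z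
«`h ≤ l²`, `logq ≤ h`, `½ ≤ c`, `c·l ≤ E`, `0 ≤ B`, `2l ≤ u` ⟹ `logq ≤ u·(B + E)`»): with [IUTchIV] Cor 2.2 (P1) `h^{1/2} ≤ l` and `E ≥ c·l` for any `c ≥ ½`, ANY
`u ≥ 2l` (in particular `u₁(l)`) makes the display content-free — hence requirement S5. No side taken. [folklore] -/
theorem downstream_vacuous_of_window {l : ℕ} {h logq c E B u : ℝ} (hl : (h : ℝ) ≤ (l : ℝ) ^ 2) (hq : logq ≤ h) (hc : 1 / 2 ≤ c)
    (hE : c * l ≤ E) (hB : 0 ≤ B) (hu : 2 * (l : ℝ) ≤ u) : logq ≤ u * (B + E) := by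
  have hl0 : (0 : ℝ) ≤ l := Nat.cast_nonneg l
  have hE0 : 0 ≤ E := le_trans (by positivity) hE
  calc logq ≤ (l : ℝ) ^ 2 := hq.trans hl
    _ = 2 * (l : ℝ) * ((1 / 2) * l) := by ring
    _ ≤ 2 * (l : ℝ) * (c * l) := by gcongr
    _ ≤ 2 * (l : ℝ) * E := by gcongr
    _ ≤ u * E := by gcongr
    _ ≤ u * (B + E) := by nlinarith [le_trans (by positivity : (0:ℝ) ≤ 2 * (l:ℝ)) hu]

/-- COROLLARY in the display's own terms: at `l = 2n+1`, `n ≥ 2`, the window hypotheses give `DownstreamDisplay l logq B E` outright (`2l < u₁(l)`,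
`R3_downstreamConstantKappaOne_holds`) — the κ′ = 1 display carries no constraint beyond its own error term. [folklore] -/
theorem downstreamDisplay_of_window {n : ℕ} (hn : 2 ≤ n) {h logq c E B : ℝ} (hl : h ≤ ((2 * n + 1 : ℕ) : ℝ) ^ 2) (hq : logq ≤ h)
    (hc : 1 / 2 ≤ c) (hE : c * ((2 * n + 1 : ℕ) : ℝ) ≤ E) (hB : 0 ≤ B) : DownstreamDisplay (2 * n + 1) logq B E := by
  unfold DownstreamDisplay
  have hdiv : (2 * n + 1 - 1) / 2 = n := by omega
  rw [hdiv]
  refine downstream_vacuous_of_window hl hq hc hE hB ?_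
  have hu := ((R3_downstreamConstantKappaOne_holds n hn).2).le
  push_cast at hu ⊢
  exact hu

/-- **Sheet S5 (bounded-`l` initial Θ-data) — forced by R6**, §K1-CORE (b2) «an `l`-selection for the initial Θ-data ([IUTchI] Def 3.1 (a)–(f)) with `l ≤ l₀`
INDEPENDENT of the height of `E_F` (Def 3.1 (c) …), replacing [IUTchIV] Cor 2.2's choice `l ~ √h` … Whether such an `l₀` serves ALL data of a Szpiro/abc
family: NOT DECIDABLE HERE»: `D` = the family of data the κ′ = 1 chain is run on (each an initial Θ-datum, the tree's `Literature.IUT.HodgeTheaters.InitialThetaData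
F K Fbar E l P`, or its shadow in our currency), `lOf d` = its prime `l` (Def 3.1 (c)); the requirement is a UNIFORM bound. What would supply it (sheet): a uniform
irreducibility / isogeny bound over the fields of the family (Serre-uniformity type) — outside the cell currency; typed, not claimed. VACUOUS on any finite bed
(`S5_boundedPrime_of_finite`); FAILS along print's `√h`-window on a family of unbounded height (`not_S5_boundedPrime_of_window`). [claim: Mochizuki2012, status: disputed] -/
@[claim "Mochizuki2012" "disputed"]
def S5_boundedPrime {D : Type*} (lOf : D → ℕ) : Prop :=
  ∃ l₀ : ℕ, ∀ d : D, lOf d ≤ l₀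

/-- VACUITY FLAG: on any FINITE family (e.g. the 133 FREY133 + 79 HEX79 bed data) S5 holds trivially — it bites only on an infinite family. [folklore] -/
theorem S5_boundedPrime_of_finite {D : Type*} [Finite D] (lOf : D → ℕ) : S5_boundedPrime lOf := by
  classical
  haveI := Fintype.ofFinite D
  exact ⟨Finset.univ.sup lOf, fun d => Finset.le_sup (Finset.mem_univ d)⟩

/-- … whereas a selection inside print's window `h(d) ≤ l(d)²` ([IUTchIV] Cor 2.2 (P1) `h^{1/2} ≤ l`) along a family of UNBOUNDED height `h` is NOT bounded:
S5 and the `√h`-window are incompatible on such a family. Pure arithmetic. [folklore] -/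
theorem not_S5_boundedPrime_of_window {D : Type*} {lOf : D → ℕ} {h : D → ℝ} (hw : ∀ d, h d ≤ (lOf d : ℝ) ^ 2)
    (hu : ∀ B : ℝ, ∃ d, B < h d) : ¬ S5_boundedPrime lOf := by
  rintro ⟨l₀, hl⟩
  obtain ⟨d, hd⟩ := hu ((l₀ : ℝ) ^ 2)
  have h1 : (lOf d : ℝ) ≤ (l₀ : ℝ) := by exact_mod_cast hl d
  have h2 : (lOf d : ℝ) ^ 2 ≤ (l₀ : ℝ) ^ 2 := by gcongr
  linarith [hw d]

end KappaOneCore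

/-! ## §8. CFG-01 / CFG-02 / CFG-03 (`P-k1kappa1-k5mu27/64`, `-mu1/2`, `-mu3/4`): one packaging def per configuration -/

section CFG010203

variable {ι : Type*} {D : Type*}

/-- **K1-KAPPA1 — «what a κ′ = 1 theory with threshold μ₀ must SUPPLY»**, the family's packaging def at a datum (places `s`, integer place data
`(e, m, δ, r_in, r_out)`, weights `u`, `L = l⋆`) and along the family's `l`-selection `lOf` (§K1-CORE (b1) R1–R6 + (b2) S1–S5, CROSSWALK 12:54:52Z): (R2) every
label licensed at every place AND (R3) the MEETS word `DD ≤ (1 − μ₀)·M₁` (part A `R1_meets 2 μ₀`, `datum_meets_iff` p522952) ∧ mass re-normalisation to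
`M₁ = reqMass (lawPow 2) …` (part A `R2_massRenormalisation 2`; ratio word `row_kappaOne_ratio` p519304) ∧ the downstream constant `u₁(l)` (sheet R4) ∧ S1–S3 = part A's
`R4_thetaSection 2` (a «1-theta section»: value law / class law / values with exponent law `lawPow 2 |n| = |n|`), `R5_cyclotomicRigidity 2`, `R6_pilotDegreeLaw 2`
∧ S5 `S5_boundedPrime lOf`. S4 is «exactly R2 ∧ R3» (sheet). HYPOTHESIS in OUR typed cell currency; nothing here asserts that such a theory exists.
[claim: Mochizuki2012, status: disputed] -/
@[claim "Mochizuki2012" "disputed"]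
def KappaOne_requirement (μ₀ : ℝ) (lOf : D → ℕ) (s : Finset ι) (e m δ rin rout : ι → ℤ) (u : ι → ℝ) (L : ℕ) : Prop :=
  ((∀ w ∈ s, LicenceAllLabels 2 (e w) (m w) (δ w) (rin w) (rout w) L) ∧ R1_meets 2 μ₀ s e m δ rin rout u L) ∧
    R2_massRenormalisation 2 ∧ R3_downstreamConstantKappaOne ∧ R4_thetaSection 2 ∧ R5_cyclotomicRigidity 2 ∧ R6_pilotDegreeLaw 2 ∧
      S5_boundedPrime lOf

/-- **CFG-01** (point_id `P-k1kappa1-k5mu27/64`; knobs «k1=kappa:1 k2=print c=1 cD=1 pk=j+1 rnd=floor mu0=27/64»; sheet `AXIS-C/CFG-01-P-k1kappa1-k5mu27_64.md` v2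
b48b9637cf79f32d; (a) loci §K1-CORE A1–A15: [EtTh] §1 p.16–17, p.19–20, Prop 1.4 p.20, Prop 1.5 p.21, Cor 2.19 / Rmk 2.19.2 p.61; [IUTchII] Rmk 2.5.1 (i) p.72, Rmk 3.6.4 (iv)
p.107; [IUTchIII] Rmk 2.1.1 (iv) p.62, 2.2.1 (iv) p.69, 2.2.2 (i) p.69–70, 2.3.3 (vi)/(vii) p.80–82, Def 3.8 / Rmk 3.9.3, Rmk 3.12.1 (ii) p.186; [IUTchIV] Thm 1.10 Step (v) p.27–29, Cor 2.2 (P1) p.45): `KappaOne_requirement (27/64)` (sheet `CFG01_MeetsAt := MeetsAt (27/64)`; bed words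
BY NAME: 133/133 ∧ 79/79 at tiers L0 and L1, `bed_kappaOne_all` p508362 + `exception_datum_words_L0` / `_L1` p512285). HYPOTHESIS. [claim: Mochizuki2012, status: disputed] -/
@[claim "Mochizuki2012" "disputed"]
def CFG01_requirement (lOf : D → ℕ) (s : Finset ι) (e m δ rin rout : ι → ℤ) (u : ι → ℝ) (L : ℕ) : Prop :=
  KappaOne_requirement (27 / 64) lOf s e m δ rin rout u L

/-- **CFG-02** (point_id `P-k1kappa1-k5mu1/2`; knobs «… mu0=1/2»; sheet `AXIS-C/CFG-02-P-k1kappa1-k5mu1_2.md` v2 a08e20e4aa0aeaf4; loci as CFG-01):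
`KappaOne_requirement (1/2)` (sheet `CFG02_MeetsAt := MeetsAt (1/2)`; bed words 133/133 ∧ 79/79 at L0 and L1 by the same names; ρ_min 1.9382 IS the exception datum
`…134881:7`, μ_L1 = 0.9691 — engine numbers, not kernel numerals). HYPOTHESIS. [claim: Mochizuki2012, status: disputed] -/
@[claim "Mochizuki2012" "disputed"]
def CFG02_requirement (lOf : D → ℕ) (s : Finset ι) (e m δ rin rout : ι → ℤ) (u : ι → ℝ) (L : ℕ) : Prop :=
  KappaOne_requirement (1 / 2) lOf s e m δ rin rout u L

/-- **CFG-03** (point_id `P-k1kappa1-k5mu3/4`; knobs «… mu0=3/4»; sheet `AXIS-C/CFG-03-P-k1kappa1-k5mu3_4.md` v2 20054eaad1a1d4d1; loci as CFG-01):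
`KappaOne_requirement (3/4)` (sheet `CFG03_MeetsAt := MeetsAt (3/4)`; bed words 133/133 ∧ 79/79 at tier L1, 132/133 on FREY133 at tier L0 — `exception_datum_words_L0`
third conjunct `> 0`, `_L1` third conjunct `= 0`, p512285). HYPOTHESIS. [claim: Mochizuki2012, status: disputed] -/
@[claim "Mochizuki2012" "disputed"]
def CFG03_requirement (lOf : D → ℕ) (s : Finset ι) (e m δ rin rout : ι → ℤ) (u : ι → ℝ) (L : ℕ) : Prop :=
  KappaOne_requirement (3 / 4) lOf s e m δ rin rout u L

/-- The bookkeeping conjuncts of the κ′ = 1 family HOLD in our currency: mass re-normalisation (`reqMass_div_reqMass`), the downstream constant (`uConst_id`,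
`two_mul_lt_uConst_id`), the pilot-degree law (`deg_divisorOn_pow`). [folklore] -/
theorem KappaOne_bookkeeping_holds : R2_massRenormalisation 2 ∧ R3_downstreamConstantKappaOne ∧ R6_pilotDegreeLaw 2 :=
  ⟨R2_massRenormalisation_holds 2, R3_downstreamConstantKappaOne_holds, R6_pilotDegreeLaw_holds 2⟩

/-- Hence `KappaOne_requirement μ₀` REDUCES to: all labels licensed + the MEETS word, the 1-theta section (S1), its cyclotomic rigidity (S2), and the bounded-`l`
selection (S5). [folklore] -/
theorem KappaOne_requirement_iff (μ₀ : ℝ) (lOf : D → ℕ) (s : Finset ι) (e m δ rin rout : ι → ℤ) (u : ι → ℝ) (L : ℕ) :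
    KappaOne_requirement μ₀ lOf s e m δ rin rout u L ↔
      ((∀ w ∈ s, LicenceAllLabels 2 (e w) (m w) (δ w) (rin w) (rout w) L) ∧ R1_meets 2 μ₀ s e m δ rin rout u L) ∧
        R4_thetaSection 2 ∧ R5_cyclotomicRigidity 2 ∧ S5_boundedPrime lOf := by
  obtain ⟨h2, h3, h6⟩ := KappaOne_bookkeeping_holds
  unfold KappaOne_requirement
  constructor
  · rintro ⟨h1, -, -, h4, h5, -, hS⟩; exact ⟨h1, h4, h5, hS⟩
  · rintro ⟨h1, h4, h5, hS⟩; exact ⟨h1, h2, h3, h4, h5, h6, hS⟩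

/-- MONOTONICITY IN THE TARGET (sheet `meetsAt_mono`, by part A's `R1_meets_anti`): for `μ₀′ ≤ μ₀` and `M₁ ≥ 0`, a datum meeting the `μ₀` configuration meets the
`μ₀′` one — so CFG-03 ⟹ CFG-02 ⟹ CFG-01 datum by datum. [folklore] -/
theorem KappaOne_requirement_anti {μ₀ μ₀' : ℝ} (hμ : μ₀' ≤ μ₀) {lOf : D → ℕ} {s : Finset ι} {e m δ rin rout : ι → ℤ} {u : ι → ℝ} {L : ℕ}
    (hM : 0 ≤ reqMass (lawPow 2) 1 L (∑ w ∈ s, (m w : ℝ) * u w)) (h : KappaOne_requirement μ₀ lOf s e m δ rin rout u L) :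
    KappaOne_requirement μ₀' lOf s e m δ rin rout u L := by
  obtain ⟨⟨hl, hm⟩, hrest⟩ := h
  exact ⟨⟨hl, R1_meets_anti hμ hM hm⟩, hrest⟩

/-- CFG-03 ⟹ CFG-02 at a datum with `M₁ ≥ 0`. [folklore] -/
theorem CFG02_requirement_of_CFG03 {lOf : D → ℕ} {s : Finset ι} {e m δ rin rout : ι → ℤ} {u : ι → ℝ} {L : ℕ}
    (hM : 0 ≤ reqMass (lawPow 2) 1 L (∑ w ∈ s, (m w : ℝ) * u w)) (h : CFG03_requirement lOf s e m δ rin rout u L) :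
    CFG02_requirement lOf s e m δ rin rout u L :=
  KappaOne_requirement_anti (by norm_num) hM h

/-- CFG-02 ⟹ CFG-01 at a datum with `M₁ ≥ 0`. [folklore] -/
theorem CFG01_requirement_of_CFG02 {lOf : D → ℕ} {s : Finset ι} {e m δ rin rout : ι → ℤ} {u : ι → ℝ} {L : ℕ}
    (hM : 0 ≤ reqMass (lawPow 2) 1 L (∑ w ∈ s, (m w : ℝ) * u w)) (h : CFG02_requirement lOf s e m δ rin rout u L) :
    CFG01_requirement lOf s e m δ rin rout u L :=
  KappaOne_requirement_anti (by norm_num) hM h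

end CFG010203

end Summit.ABC.IUTFork.Repair.RH.AxisCK1Requirements

end
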